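import Summits.QuantumFields.BalabanUV.T4Continuum.Support.UnitaryRootInterpolation
import HarnessLib

/-!
# T⁴ programme, row NE7 — (154a) SECOND-ORDER LATTICE CALCULUS FOR `exp` AND THE SERIES LOGARITHM: parallelogram
# second differences of `x ↦ xᵏ`, `x ↦ eˣ − 1 − x` and `G ↦ log G − (G − 1)` (`NE7ExpLogSecondOrder`)

Cell `pub-balaban`, lineage `t4-ne7-p2` (CRUX PROVER NE7 #2), gen 86.  First file of the kernel chain (154) = road (β′) of
PRICING-NE7 §419 ∕ `g85/HFLATTOP-MEMO.md` §4: a C² corner-gauge interpolation `w` of unitary coarse data (`w(Mz) = v z`, first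
differences `O(ω∕M)`, second differences `O(ω∕M²)`) which strikes the END's normalisation `hflatTop` by re-gauging.  The
interpolant is built from two-point geodesics `b₀ (b₀⁻¹b₁)^s` (tree `UnitaryGeodesic.geo`) sampled at smoothstep parameters,
and its SECOND differences across two already-interpolated directions need second-order control of the two nonlinear maps
`exp` and `log`.  THIS FILE is that control, in any complete normed `ℂ`-algebra with `‖1‖ = 1`, for the PARALLELOGRAM
second difference `pg a₁ a₂ a₃ a₄ := a₄ − a₃ − a₂ + a₁` of four points (values at `y`, `y + e_μ`, `y + e_τ`, `y + e_μ + e_τ`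
of a lattice map; `a₂ = a₃` is the collinear case):
§1 `pg` and the exact product rule `pg (a·b) = (pg a)·b₄ + (a₃ − a₁)(b₄ − b₃) + (a₂ − a₁)(b₄ − b₂) + a₁·(pg b)` with its norm
form; §2 powers: `‖pg (x^{k+2})‖ ≤ (k+2)ρ^{k+1}·δ + (k+2)(k+1)ρ^k·l·m` on `‖xᵢ‖ ≤ ρ` (sides `l`, `m`, `‖pg x‖ ≤ δ`);
§3 the exponential tail `T x := eˣ − 1 − x = Σ_{k≥0} x^{k+2}∕(k+2)!`: the first-order Lipschitz bound
`‖T x − T y‖ ≤ (e^ρ − 1)‖x − y‖` and `‖pg (T x)‖ ≤ (e^ρ − 1)δ + e^ρ·l·m`, hence `‖pg (eˣ)‖ ≤ e^ρ(δ + l·m)`;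
§4 the series logarithm `log` (tree `MatrixLog.mlog`, (21) of [Balaban1985Averaging]) by INVERSION (`e^{log G} = G`): on
`‖Gᵢ − 1‖ ≤ ρ ≤ 1∕4`, `‖pg (log G)‖ ≤ 3δ + 9·l·m` and the remainder form `‖pg (log G) − pg G‖ ≤ 12ρ·δ + 12·l·m`.
The two-point forms are the tree's `FederbushMean.norm_mlog_sub_mlog_sub_le` ∕ `norm_mlog_sub_sub_one_le` (not restated).

HONEST FRAMING (page 1): [folklore] Banach-algebra calculus (power series termwise); constants `3, 9, 12` are this file's
(not optimised).  Nothing of Bałaban's is used or claimed; nothing about gauge fields; (APE) NOT proved; NE7 NOT PRINTED ∕ NOT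
PROVED; spine 0∕9; finite T⁴ rung (B)+1 — NOT infinite volume, NOT mass gap, NOT Clay.  No `sorry`; axioms ⊆ {propext,
Classical.choice, Quot.sound}.  PLACEMENT (human rule 2026-08-19): our lemma, under `Summits/QuantumFields/BalabanUV/`;
imports `Support/UnitaryRootInterpolation` (for `mlog` and its Lipschitz bounds) only.
Continuum YM on T⁴ ⇐ BetaPertH ∧ nine spine estimates (0/9 proved); BetaPertH ⇐ (D1) ∧ (D4) ∧ CAP+tail; G-an2-4 gates asym, D1 and NE2/3/4.
-/

set_option autoImplicit false

open NormedSpace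
open scoped BigOperators

namespace Summit.QuantumFields.BalabanUV.T4Continuum.NE7ExpLogSecondOrder

open Literature.MathematicalPhysics.QuantumFieldTheory.Balaban1983to89
open MatrixLog

noncomputable section

variable {𝔸 : Type*} [NormedRing 𝔸] [NormedAlgebra ℂ 𝔸] [CompleteSpace 𝔸] [NormOneClass 𝔸]

/-! ## §1 The parallelogram second difference and its product rule -/

/-! Throughout, `pg a₁ a₂ a₃ a₄ := a₄ − a₃ − a₂ + a₁` denotes (in the docstrings only; statements are written out) the
parallelogram second difference of four points `a₁ = f y`, `a₂ = f (y + e_μ)`, `a₃ = f (y + e_τ)`, `a₄ = f (y + e_μ + e_τ)`. -/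

omit [NormedAlgebra ℂ 𝔸] [CompleteSpace 𝔸] [NormOneClass 𝔸] in
/-- `pg` of a constant vanishes. [folklore] -/
theorem pg_const (c : 𝔸) : (c - c - c + c) = 0 := by abel

omit [NormedAlgebra ℂ 𝔸] [CompleteSpace 𝔸] [NormOneClass 𝔸] in
/-- `pg` is additive. [folklore] -/
theorem pg_add (a₁ a₂ a₃ a₄ b₁ b₂ b₃ b₄ : 𝔸) :
    ((a₄ + b₄) - (a₃ + b₃) - (a₂ + b₂) + (a₁ + b₁)) = (a₄ - a₃ - a₂ + a₁) + (b₄ - b₃ - b₂ + b₁) := by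
  abel

omit [NormedAlgebra ℂ 𝔸] [CompleteSpace 𝔸] [NormOneClass 𝔸] in
/-- Subtracting the same constant from the four points does not change `pg`. [folklore] -/
theorem pg_sub_const (a₁ a₂ a₃ a₄ c : 𝔸) : ((a₄ - c) - (a₃ - c) - (a₂ - c) + (a₁ - c)) = (a₄ - a₃ - a₂ + a₁) := by
  abel

omit [CompleteSpace 𝔸] [NormOneClass 𝔸] in
/-- `pg` is homogeneous under real scalars. [folklore] -/
theorem pg_smul (s : ℝ) (a₁ a₂ a₃ a₄ : 𝔸) :
    ((s • a₄) - (s • a₃) - (s • a₂) + (s • a₁)) = s • (a₄ - a₃ - a₂ + a₁) := by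
  simp only [smul_sub, smul_add]

omit [NormedAlgebra ℂ 𝔸] [CompleteSpace 𝔸] [NormOneClass 𝔸] in
/-- Left multiplication by a constant. [folklore] -/
theorem pg_const_mul (c a₁ a₂ a₃ a₄ : 𝔸) : ((c * a₄) - (c * a₃) - (c * a₂) + (c * a₁)) = c * (a₄ - a₃ - a₂ + a₁) := by
  simp only [mul_sub, mul_add]

omit [NormedAlgebra ℂ 𝔸] [CompleteSpace 𝔸] [NormOneClass 𝔸] in
/-- **The product rule** for the parallelogram second difference (exact, non-commutative):
`pg (a·b) = (pg a)·b₄ + (a₃ − a₁)(b₄ − b₃) + (a₂ − a₁)(b₄ − b₂) + a₁·(pg b)`. [folklore] -/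
theorem pg_mul (a₁ a₂ a₃ a₄ b₁ b₂ b₃ b₄ : 𝔸) :
    ((a₄ * b₄) - (a₃ * b₃) - (a₂ * b₂) + (a₁ * b₁))
      = (a₄ - a₃ - a₂ + a₁) * b₄ + (a₃ - a₁) * (b₄ - b₃) + (a₂ - a₁) * (b₄ - b₂) + a₁ * (b₄ - b₃ - b₂ + b₁) := by
  simp only [mul_sub, sub_mul, mul_add, add_mul]
  abel

omit [NormedAlgebra ℂ 𝔸] [CompleteSpace 𝔸] [NormOneClass 𝔸] in
/-- **Norm form of the product rule**: with `‖aᵢ‖ ≤ A`, `‖bᵢ‖ ≤ B`, sides `la, ma` ∕ `lb, mb` and `‖pg a‖ ≤ δa`,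
`‖pg b‖ ≤ δb`: `‖pg (a·b)‖ ≤ δa·B + ma·lb + la·mb + A·δb`. [folklore] -/
theorem norm_pg_mul_le {a₁ a₂ a₃ a₄ b₁ b₂ b₃ b₄ : 𝔸} {A B la ma lb mb δa δb : ℝ}
    (hA : ‖a₁‖ ≤ A) (hB : ‖b₄‖ ≤ B)
    (ha12 : ‖a₂ - a₁‖ ≤ la) (ha13 : ‖a₃ - a₁‖ ≤ ma) (hb34 : ‖b₄ - b₃‖ ≤ lb) (hb24 : ‖b₄ - b₂‖ ≤ mb)
    (hδa : ‖(a₄ - a₃ - a₂ + a₁)‖ ≤ δa) (hδb : ‖(b₄ - b₃ - b₂ + b₁)‖ ≤ δb) :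
    ‖((a₄ * b₄) - (a₃ * b₃) - (a₂ * b₂) + (a₁ * b₁))‖ ≤ δa * B + ma * lb + la * mb + A * δb := by
  rw [pg_mul]
  have h0 : 0 ≤ la := (norm_nonneg _).trans ha12
  have h0' : 0 ≤ ma := (norm_nonneg _).trans ha13
  have h0'' : 0 ≤ B := (norm_nonneg _).trans hB
  have h0''' : 0 ≤ A := (norm_nonneg _).trans hA
  refine (norm_add_le _ _).trans (add_le_add ((norm_add_le _ _).trans (add_le_add ((norm_add_le _ _).trans
    (add_le_add ?_ ?_)) ?_)) ?_)
  · exact (norm_mul_le _ _).trans (mul_le_mul hδa hB (norm_nonneg _) ((norm_nonneg _).trans hδa))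
  · exact (norm_mul_le _ _).trans (mul_le_mul ha13 hb34 (norm_nonneg _) h0')
  · exact (norm_mul_le _ _).trans (mul_le_mul ha12 hb24 (norm_nonneg _) h0)
  · exact (norm_mul_le _ _).trans (mul_le_mul hA hδb (norm_nonneg _) h0''')

/-! ## §2 Powers -/

omit [NormedAlgebra ℂ 𝔸] [CompleteSpace 𝔸] in
/-- **Second differences of powers**: on `‖xᵢ‖ ≤ ρ`, with sides `‖x₂ − x₁‖, ‖x₄ − x₃‖ ≤ l`, `‖x₃ − x₁‖, ‖x₄ − x₂‖ ≤ m`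
and `‖pg x‖ ≤ δ`: `‖pg (x^{k+2})‖ ≤ (k+2)ρ^{k+1}δ + (k+2)(k+1)ρᵏ·l·m` (induction on `k` with the product rule). [folklore] -/
theorem norm_pg_pow_le {x₁ x₂ x₃ x₄ : 𝔸} {ρ l m δ : ℝ}
    (h₁ : ‖x₁‖ ≤ ρ) (h₂ : ‖x₂‖ ≤ ρ) (h₃ : ‖x₃‖ ≤ ρ) (h₄ : ‖x₄‖ ≤ ρ)
    (h12 : ‖x₂ - x₁‖ ≤ l) (h34 : ‖x₄ - x₃‖ ≤ l) (h13 : ‖x₃ - x₁‖ ≤ m) (h24 : ‖x₄ - x₂‖ ≤ m)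
    (hδ : ‖(x₄ - x₃ - x₂ + x₁)‖ ≤ δ) (k : ℕ) :
    ‖((x₄ ^ (k + 2)) - (x₃ ^ (k + 2)) - (x₂ ^ (k + 2)) + (x₁ ^ (k + 2)))‖
      ≤ (k + 2) * ρ ^ (k + 1) * δ + (k + 2) * (k + 1) * ρ ^ k * (l * m) := by
  have hρ0 : 0 ≤ ρ := (norm_nonneg _).trans h₁
  have hl0 : 0 ≤ l := (norm_nonneg _).trans h12
  have hm0 : 0 ≤ m := (norm_nonneg _).trans h13
  have hδ0 : 0 ≤ δ := (norm_nonneg _).trans hδ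
  induction k with
  | zero =>
    have h := norm_pg_mul_le (a₁ := x₁) (a₂ := x₂) (a₃ := x₃) (a₄ := x₄) (b₁ := x₁) (b₂ := x₂) (b₃ := x₃) (b₄ := x₄)
      h₁ h₄ h12 h13 h34 h24 hδ hδ
    have e2 : ∀ i : 𝔸, i ^ (0 + 2) = i * i := fun i => by rw [zero_add, sq]
    simp only [e2]
    calc ‖((x₄ * x₄) - (x₃ * x₃) - (x₂ * x₂) + (x₁ * x₁))‖ ≤ δ * ρ + m * l + l * m + ρ * δ := h
      _ = ((0 : ℕ) + 2 : ℝ) * ρ ^ (0 + 1) * δ + ((0 : ℕ) + 2 : ℝ) * ((0 : ℕ) + 1) * ρ ^ 0 * (l * m) := by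
          push_cast; ring
  | succ k ih =>
    -- `x^{k+3} = x^{k+2} · x`
    have hp : ∀ i : 𝔸, i ^ (k + 1 + 2) = i ^ (k + 2) * i := fun i => by rw [show k + 1 + 2 = (k + 2) + 1 by omega, pow_succ]
    have hn : ∀ {i : 𝔸}, ‖i‖ ≤ ρ → ‖i ^ (k + 2)‖ ≤ ρ ^ (k + 2) := fun hi =>
      (norm_pow_le' _ (by omega)).trans (pow_le_pow_left₀ (norm_nonneg _) hi _)
    -- first differences of powers (tree `norm_pow_succ_sub_pow_succ_le`, `max ‖·‖ ≤ ρ`)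
    have hP1 : ∀ {x y : 𝔸}, ‖x‖ ≤ ρ → ‖y‖ ≤ ρ →
        ‖x ^ (k + 1 + 1) - y ^ (k + 1 + 1)‖ ≤ (↑(k + 1) + 1) * ρ ^ (k + 1) * ‖x - y‖ := fun {x y} hx hy => by
      have h := Literature.Analysis.Complex.norm_pow_succ_sub_pow_succ_le x y (k + 1)
      have hm0 : 0 ≤ max ‖x‖ ‖y‖ := (norm_nonneg _).trans (le_max_left _ _)
      calc ‖x ^ (k + 1 + 1) - y ^ (k + 1 + 1)‖ ≤ (↑(k + 1) + 1) * max ‖x‖ ‖y‖ ^ (k + 1) * ‖x - y‖ := h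
        _ ≤ (↑(k + 1) + 1) * ρ ^ (k + 1) * ‖x - y‖ := by gcongr; exact max_le hx hy
    have h13' : ‖x₃ ^ (k + 2) - x₁ ^ (k + 2)‖ ≤ (k + 2) * ρ ^ (k + 1) * m := by
      have := hP1 h₃ h₁
      calc ‖x₃ ^ (k + 2) - x₁ ^ (k + 2)‖ ≤ (↑(k + 1) + 1) * ρ ^ (k + 1) * ‖x₃ - x₁‖ := this
        _ ≤ (↑(k + 1) + 1) * ρ ^ (k + 1) * m := by gcongr
        _ = (k + 2) * ρ ^ (k + 1) * m := by push_cast; ring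
    have h12' : ‖x₂ ^ (k + 2) - x₁ ^ (k + 2)‖ ≤ (k + 2) * ρ ^ (k + 1) * l := by
      have := hP1 h₂ h₁
      calc ‖x₂ ^ (k + 2) - x₁ ^ (k + 2)‖ ≤ (↑(k + 1) + 1) * ρ ^ (k + 1) * ‖x₂ - x₁‖ := this
        _ ≤ (↑(k + 1) + 1) * ρ ^ (k + 1) * l := by gcongr
        _ = (k + 2) * ρ ^ (k + 1) * l := by push_cast; ring
    have h := norm_pg_mul_le (a₁ := x₁ ^ (k + 2)) (a₂ := x₂ ^ (k + 2)) (a₃ := x₃ ^ (k + 2)) (a₄ := x₄ ^ (k + 2))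
      (b₁ := x₁) (b₂ := x₂) (b₃ := x₃) (b₄ := x₄) (hn h₁) h₄ h12' h13' h34 h24 ih hδ
    simp only [hp]
    calc ‖((x₄ ^ (k + 2) * x₄) - (x₃ ^ (k + 2) * x₃) - (x₂ ^ (k + 2) * x₂) + (x₁ ^ (k + 2) * x₁))‖
        ≤ ((k + 2) * ρ ^ (k + 1) * δ + (k + 2) * (k + 1) * ρ ^ k * (l * m)) * ρ
          + (k + 2) * ρ ^ (k + 1) * m * l + (k + 2) * ρ ^ (k + 1) * l * m + ρ ^ (k + 2) * δ := h
      _ = (↑(k + 1) + 2) * ρ ^ (k + 1 + 1) * δ + (↑(k + 1) + 2) * (↑(k + 1) + 1) * ρ ^ (k + 1) * (l * m) := by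
          push_cast; ring

/-! ## §3 The exponential tail `T x = eˣ − 1 − x` -/

/-! The exponential tail is `T x := exp x − 1 − x` (docstring shorthand; statements are written out). -/

omit [NormOneClass 𝔸] in
/-- The tail is the series `Σ_{k≥0} x^{k+2}∕(k+2)!`. [folklore] -/
theorem hasSum_expTail (x : 𝔸) :
    HasSum (fun k : ℕ => (((k + 2).factorial : ℂ)⁻¹) • x ^ (k + 2)) ((exp x - 1 - x)) := by
  have h1 : HasSum (fun n : ℕ => ((n.factorial : ℂ)⁻¹) • x ^ n) (exp x) := exp_series_hasSum_exp' (𝕂 := ℂ) x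
  have h2 := (hasSum_nat_add_iff' 2).mpr h1
  have hs : ∑ i ∈ Finset.range 2, ((i.factorial : ℂ)⁻¹) • x ^ i = 1 + x := by
    simp [Finset.sum_range_succ]
  rw [hs] at h2
  simpa [sub_sub] using h2

omit [NormOneClass 𝔸] in
/-- The real majorant `Σ ρ^{k+1}∕(k+1)! = e^ρ − 1`. [folklore] -/
theorem hasSum_real_exp_shift_one (ρ : ℝ) :
    HasSum (fun k : ℕ => ρ ^ (k + 1) / ((k + 1).factorial : ℝ)) (Real.exp ρ - 1) := by
  have h : HasSum (fun n : ℕ => ρ ^ n / (n.factorial : ℝ)) (Real.exp ρ) := by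
    rw [Real.exp_eq_exp_ℝ]; exact expSeries_div_hasSum_exp ρ
  have h2 := (hasSum_nat_add_iff' 1).mpr h
  simpa using h2

omit [NormOneClass 𝔸] in
/-- `e^ρ − 1 ≤ 2ρ` for `0 ≤ ρ ≤ 1` (Mathlib `Real.abs_exp_sub_one_le`). [folklore] -/
theorem real_exp_sub_one_le_two_mul {ρ : ℝ} (h0 : 0 ≤ ρ) (h1 : ρ ≤ 1) : Real.exp ρ - 1 ≤ 2 * ρ := by
  have h := Real.abs_exp_sub_one_le (x := ρ) (by rwa [abs_of_nonneg h0])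
  rw [abs_of_nonneg h0] at h
  exact (le_abs_self _).trans h

omit [NormOneClass 𝔸] in
/-- `e^{1∕2} ≤ 5∕3` (from `e < 2.7182818286 < 25∕9`). [folklore] -/
theorem real_exp_half_le : Real.exp (1 / 2 : ℝ) ≤ 5 / 3 := by
  have h1 : Real.exp (1 / 2 : ℝ) ^ 2 = Real.exp 1 := by rw [← Real.exp_nat_mul]; norm_num
  have h2 : Real.exp 1 < 25 / 9 := lt_trans Real.exp_one_lt_d9 (by norm_num)
  nlinarith [Real.exp_pos (1 / 2 : ℝ), h1, h2, sq_nonneg (Real.exp (1 / 2 : ℝ) - 5 / 3)]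

omit [NormOneClass 𝔸] in
/-- `e^{2ρ} ≤ 5∕3` for `ρ ≤ 1∕4`. [folklore] -/
theorem real_exp_two_mul_le {ρ : ℝ} (hρ : ρ ≤ 1 / 4) : Real.exp (2 * ρ) ≤ 5 / 3 :=
  (Real.exp_le_exp.mpr (by linarith)).trans real_exp_half_le

/-- **First-order Lipschitz bound of the tail**: `‖T x − T y‖ ≤ (e^ρ − 1)·‖x − y‖` on `‖x‖, ‖y‖ ≤ ρ` (termwise
`‖x^{k+2} − y^{k+2}‖ ≤ (k+2)ρ^{k+1}‖x − y‖`, and `Σ (k+2)ρ^{k+1}∕(k+2)! = e^ρ − 1`). [folklore] -/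
theorem norm_expTail_sub_expTail_le {x y : 𝔸} {ρ : ℝ} (hx : ‖x‖ ≤ ρ) (hy : ‖y‖ ≤ ρ) :
    ‖(exp x - 1 - x) - (exp y - 1 - y)‖ ≤ (Real.exp ρ - 1) * ‖x - y‖ := by
  have hs := (hasSum_expTail x).sub (hasSum_expTail y)
  have hmaj : HasSum (fun k : ℕ => ρ ^ (k + 1) / ((k + 1).factorial : ℝ) * ‖x - y‖) ((Real.exp ρ - 1) * ‖x - y‖) :=
    (hasSum_real_exp_shift_one ρ).mul_right _
  refine hs.norm_le_of_bounded hmaj fun k => ?_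
  rw [← smul_sub, norm_smul, norm_inv, Complex.norm_natCast]
  have hk : ‖x ^ (k + 1 + 1) - y ^ (k + 1 + 1)‖ ≤ (↑(k + 1) + 1) * ρ ^ (k + 1) * ‖x - y‖ := by
    have h := Literature.Analysis.Complex.norm_pow_succ_sub_pow_succ_le x y (k + 1)
    have hm0 : 0 ≤ max ‖x‖ ‖y‖ := (norm_nonneg _).trans (le_max_left _ _)
    calc ‖x ^ (k + 1 + 1) - y ^ (k + 1 + 1)‖ ≤ (↑(k + 1) + 1) * max ‖x‖ ‖y‖ ^ (k + 1) * ‖x - y‖ := h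
      _ ≤ (↑(k + 1) + 1) * ρ ^ (k + 1) * ‖x - y‖ := by gcongr; exact max_le hx hy
  have hfac : (((k + 2).factorial : ℕ) : ℝ) = (k + 2) * ((k + 1).factorial : ℝ) := by
    rw [show k + 2 = (k + 1) + 1 by omega, Nat.factorial_succ]; push_cast; ring
  have hf0 : ((k + 1).factorial : ℝ) ≠ 0 := by positivity
  have hk2 : (k : ℝ) + 2 ≠ 0 := by positivity
  have h1 : (((k + 2).factorial : ℕ) : ℝ)⁻¹ * ((k : ℝ) + 2) = (((k + 1).factorial : ℕ) : ℝ)⁻¹ := by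
    rw [hfac]; field_simp
  rw [show k + 1 + 1 = k + 2 by omega] at hk
  calc (((k + 2).factorial : ℝ))⁻¹ * ‖x ^ (k + 2) - y ^ (k + 2)‖
      ≤ (((k + 2).factorial : ℝ))⁻¹ * ((↑(k + 1) + 1) * ρ ^ (k + 1) * ‖x - y‖) := by gcongr
    _ = ρ ^ (k + 1) / ((k + 1).factorial : ℝ) * ‖x - y‖ := by
        rw [div_eq_inv_mul]; push_cast
        linear_combination (ρ ^ (k + 1) * ‖x - y‖) * h1

/-- **Second differences of the tail**: on `‖xᵢ‖ ≤ ρ` with sides `l, m` and `‖pg x‖ ≤ δ`,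
`‖pg (T x)‖ ≤ (e^ρ − 1)·δ + e^ρ·l·m`. [folklore] -/
theorem norm_pg_expTail_le {x₁ x₂ x₃ x₄ : 𝔸} {ρ l m δ : ℝ}
    (h₁ : ‖x₁‖ ≤ ρ) (h₂ : ‖x₂‖ ≤ ρ) (h₃ : ‖x₃‖ ≤ ρ) (h₄ : ‖x₄‖ ≤ ρ)
    (h12 : ‖x₂ - x₁‖ ≤ l) (h34 : ‖x₄ - x₃‖ ≤ l) (h13 : ‖x₃ - x₁‖ ≤ m) (h24 : ‖x₄ - x₂‖ ≤ m)
    (hδ : ‖(x₄ - x₃ - x₂ + x₁)‖ ≤ δ) :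
    ‖(((exp x₄ - 1 - x₄)) - ((exp x₃ - 1 - x₃)) - ((exp x₂ - 1 - x₂)) + ((exp x₁ - 1 - x₁)))‖ ≤ (Real.exp ρ - 1) * δ + Real.exp ρ * (l * m) := by
  -- the series for `pg (T x)`, termwise
  have hs : HasSum (fun k : ℕ => (((k + 2).factorial : ℂ)⁻¹) • ((x₄ ^ (k + 2)) - (x₃ ^ (k + 2)) - (x₂ ^ (k + 2)) + (x₁ ^ (k + 2))))
      ((((exp x₄ - 1 - x₄)) - ((exp x₃ - 1 - x₃)) - ((exp x₂ - 1 - x₂)) + ((exp x₁ - 1 - x₁)))) := by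
    have h := (((hasSum_expTail x₄).sub (hasSum_expTail x₃)).sub (hasSum_expTail x₂)).add (hasSum_expTail x₁)
    simpa only [smul_sub, smul_add] using h
  -- the real majorant
  have hmaj : HasSum (fun k : ℕ => ρ ^ (k + 1) / ((k + 1).factorial : ℝ) * δ + ρ ^ k / (k.factorial : ℝ) * (l * m))
      ((Real.exp ρ - 1) * δ + Real.exp ρ * (l * m)) := by
    refine ((hasSum_real_exp_shift_one ρ).mul_right δ).add ?_
    have h : HasSum (fun n : ℕ => ρ ^ n / (n.factorial : ℝ)) (Real.exp ρ) := by
      rw [Real.exp_eq_exp_ℝ]; exact expSeries_div_hasSum_exp ρ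
    exact h.mul_right _
  refine hs.norm_le_of_bounded hmaj fun k => ?_
  rw [norm_smul, norm_inv, Complex.norm_natCast]
  have hk := norm_pg_pow_le h₁ h₂ h₃ h₄ h12 h34 h13 h24 hδ k
  have hfac1 : (((k + 2).factorial : ℕ) : ℝ) = (k + 2) * ((k + 1).factorial : ℝ) := by
    rw [show k + 2 = (k + 1) + 1 by omega, Nat.factorial_succ]; push_cast; ring
  have hfac2 : (((k + 1).factorial : ℕ) : ℝ) = (k + 1) * (k.factorial : ℝ) := by
    rw [Nat.factorial_succ]; push_cast; ring
  have hf0 : (k.factorial : ℝ) ≠ 0 := by positivity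
  have hf1 : ((k + 1).factorial : ℝ) ≠ 0 := by positivity
  have hk1 : (k : ℝ) + 1 ≠ 0 := by positivity
  have hk2 : (k : ℝ) + 2 ≠ 0 := by positivity
  have h1 : (((k + 2).factorial : ℕ) : ℝ)⁻¹ * ((k : ℝ) + 2) = (((k + 1).factorial : ℕ) : ℝ)⁻¹ := by
    rw [hfac1]; field_simp
  have h2 : (((k + 2).factorial : ℕ) : ℝ)⁻¹ * (((k : ℝ) + 2) * ((k : ℝ) + 1)) = ((k.factorial : ℕ) : ℝ)⁻¹ := by
    rw [hfac1, hfac2]; field_simp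
  calc (((k + 2).factorial : ℝ))⁻¹ * ‖((x₄ ^ (k + 2)) - (x₃ ^ (k + 2)) - (x₂ ^ (k + 2)) + (x₁ ^ (k + 2)))‖
      ≤ (((k + 2).factorial : ℝ))⁻¹ * ((k + 2) * ρ ^ (k + 1) * δ + (k + 2) * (k + 1) * ρ ^ k * (l * m)) := by gcongr
    _ = ρ ^ (k + 1) / ((k + 1).factorial : ℝ) * δ + ρ ^ k / (k.factorial : ℝ) * (l * m) := by
        rw [div_eq_inv_mul, div_eq_inv_mul]
        linear_combination (ρ ^ (k + 1) * δ) * h1 + (ρ ^ k * (l * m)) * h2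

/-- **Second differences of the exponential**: `‖pg (eˣ)‖ ≤ e^ρ·(δ + l·m)` on `‖xᵢ‖ ≤ ρ`. [folklore] -/
theorem norm_pg_exp_le {x₁ x₂ x₃ x₄ : 𝔸} {ρ l m δ : ℝ}
    (h₁ : ‖x₁‖ ≤ ρ) (h₂ : ‖x₂‖ ≤ ρ) (h₃ : ‖x₃‖ ≤ ρ) (h₄ : ‖x₄‖ ≤ ρ)
    (h12 : ‖x₂ - x₁‖ ≤ l) (h34 : ‖x₄ - x₃‖ ≤ l) (h13 : ‖x₃ - x₁‖ ≤ m) (h24 : ‖x₄ - x₂‖ ≤ m)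
    (hδ : ‖(x₄ - x₃ - x₂ + x₁)‖ ≤ δ) :
    ‖((exp x₄) - (exp x₃) - (exp x₂) + (exp x₁))‖ ≤ Real.exp ρ * (δ + l * m) := by
  have hT := norm_pg_expTail_le h₁ h₂ h₃ h₄ h12 h34 h13 h24 hδ
  have hid : ((exp x₄) - (exp x₃) - (exp x₂) + (exp x₁))
      = (((exp x₄ - 1 - x₄)) - ((exp x₃ - 1 - x₃)) - ((exp x₂ - 1 - x₂)) + ((exp x₁ - 1 - x₁))) + (x₄ - x₃ - x₂ + x₁) := by
    abel
  rw [hid]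
  calc ‖(((exp x₄ - 1 - x₄)) - ((exp x₃ - 1 - x₃)) - ((exp x₂ - 1 - x₂)) + ((exp x₁ - 1 - x₁))) + (x₄ - x₃ - x₂ + x₁)‖
      ≤ ((Real.exp ρ - 1) * δ + Real.exp ρ * (l * m)) + δ := (norm_add_le _ _).trans (add_le_add hT hδ)
    _ = Real.exp ρ * (δ + l * m) := by ring

/-! ## §4 The series logarithm by inversion -/

omit [NormOneClass 𝔸] in
/-- On `‖G − 1‖ ≤ ρ ≤ 1∕4`: `‖log G‖ ≤ 2ρ ≤ 1∕2` ((26) p. 22). [folklore] -/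
theorem norm_mlog_le_of_le {G : 𝔸} {ρ : ℝ} (hG : ‖G - 1‖ ≤ ρ) (hρ : ρ ≤ 1 / 4) : ‖mlog G‖ ≤ 2 * ρ :=
  (norm_mlog_le_two_mul (hG.trans (hρ.trans (by norm_num)))).trans (by linarith)

omit [NormOneClass 𝔸] in
/-- Lipschitz form used below: `‖log A − log B‖ ≤ (4∕3)‖A − B‖` on `‖· − 1‖ ≤ ρ ≤ 1∕4` (tree
`FederbushMean.norm_mlog_sub_mlog_le`, `1 + ρ∕(1−ρ) ≤ 4∕3`). [folklore] -/
theorem norm_mlog_sub_mlog_le_four_thirds {A B : 𝔸} {ρ : ℝ} (hρ : ρ ≤ 1 / 4) (hA : ‖A - 1‖ ≤ ρ) (hB : ‖B - 1‖ ≤ ρ) :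
    ‖mlog A - mlog B‖ ≤ 4 / 3 * ‖A - B‖ := by
  have h := FederbushMean.norm_mlog_sub_mlog_le (hρ.trans_lt (by norm_num)) hA hB
  have hρ0 : 0 ≤ ρ := (norm_nonneg _).trans hA
  have hdiv : ρ / (1 - ρ) ≤ 1 / 3 := by
    rw [div_le_iff₀ (by linarith)]; linarith
  have hfac : 1 + ρ / (1 - ρ) ≤ 4 / 3 := by linarith
  exact h.trans (mul_le_mul_of_nonneg_right hfac (norm_nonneg _))

/-- **Second differences of the logarithm** (by inversion: `G = e^X`, `X = log G`, so `pg G = pg X + pg (T X)` and §3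
absorbs `pg (T X)`): on `‖Gᵢ − 1‖ ≤ ρ ≤ 1∕4` with sides `l, m` and `‖pg G‖ ≤ δ`,
`‖pg (log G)‖ ≤ 3δ + 9·l·m`. [folklore] -/
theorem norm_pg_mlog_le {G₁ G₂ G₃ G₄ : 𝔸} {ρ l m δ : ℝ} (hρ : ρ ≤ 1 / 4)
    (h₁ : ‖G₁ - 1‖ ≤ ρ) (h₂ : ‖G₂ - 1‖ ≤ ρ) (h₃ : ‖G₃ - 1‖ ≤ ρ) (h₄ : ‖G₄ - 1‖ ≤ ρ)
    (h12 : ‖G₂ - G₁‖ ≤ l) (h34 : ‖G₄ - G₃‖ ≤ l) (h13 : ‖G₃ - G₁‖ ≤ m) (h24 : ‖G₄ - G₂‖ ≤ m)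
    (hδ : ‖(G₄ - G₃ - G₂ + G₁)‖ ≤ δ) :
    ‖((mlog G₄) - (mlog G₃) - (mlog G₂) + (mlog G₁))‖ ≤ 3 * δ + 9 * (l * m) := by
  have hρ0 : 0 ≤ ρ := (norm_nonneg _).trans h₁
  have hl0 : 0 ≤ l := (norm_nonneg _).trans h12
  have hm0 : 0 ≤ m := (norm_nonneg _).trans h13
  have hlt : ∀ {G : 𝔸}, ‖G - 1‖ ≤ ρ → ‖G - 1‖ < 1 := fun h => h.trans_lt (hρ.trans_lt (by norm_num))
  -- the logarithms, their size and their sides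
  have hX : ∀ {G : 𝔸}, ‖G - 1‖ ≤ ρ → ‖mlog G‖ ≤ 2 * ρ := fun h => norm_mlog_le_of_le h hρ
  have hL : ∀ {A B : 𝔸} {t : ℝ}, ‖A - 1‖ ≤ ρ → ‖B - 1‖ ≤ ρ → ‖A - B‖ ≤ t → ‖mlog A - mlog B‖ ≤ 4 / 3 * t :=
    fun hA hB ht => (norm_mlog_sub_mlog_le_four_thirds hρ hA hB).trans (by gcongr)
  -- `pg G = pg X + pg (T X)` since `G = X + T X + 1`
  have hGX : ∀ {G : 𝔸}, ‖G - 1‖ ≤ ρ → G = (exp (mlog G) - 1 - (mlog G)) + mlog G + 1 := fun h => by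
    rw [exp_mlog (hlt h)]; abel
  have hid : (G₄ - G₃ - G₂ + G₁) = (((exp (mlog G₄) - 1 - (mlog G₄))) - ((exp (mlog G₃) - 1 - (mlog G₃))) - ((exp (mlog G₂) - 1 - (mlog G₂))) + ((exp (mlog G₁) - 1 - (mlog G₁))))
      + ((mlog G₄) - (mlog G₃) - (mlog G₂) + (mlog G₁)) := by
    conv_lhs => rw [hGX h₁, hGX h₂, hGX h₃, hGX h₄]
    abel
  set P := ((mlog G₄) - (mlog G₃) - (mlog G₂) + (mlog G₁)) with hP
  -- §3 for the tail at `X`, radius `2ρ ≤ 1/2`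
  have hT := norm_pg_expTail_le (hX h₁) (hX h₂) (hX h₃) (hX h₄) (hL h₂ h₁ h12) (hL h₄ h₃ h34) (hL h₃ h₁ h13)
    (hL h₄ h₂ h24) (le_refl ‖P‖)
  -- numerics: `e^{2ρ} − 1 ≤ 4ρ ≤ 2/3` hence `e^{2ρ} ≤ 5/3`
  have he : Real.exp (2 * ρ) ≤ 5 / 3 := real_exp_two_mul_le hρ
  have hlm : 0 ≤ l * m := mul_nonneg hl0 hm0
  have hPle : ‖P‖ ≤ δ + ((Real.exp (2 * ρ) - 1) * ‖P‖ + Real.exp (2 * ρ) * (4 / 3 * l * (4 / 3 * m))) := by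
    have h1 : ‖P‖ ≤ ‖(G₄ - G₃ - G₂ + G₁)‖
        + ‖(((exp (mlog G₄) - 1 - (mlog G₄))) - ((exp (mlog G₃) - 1 - (mlog G₃))) - ((exp (mlog G₂) - 1 - (mlog G₂))) + ((exp (mlog G₁) - 1 - (mlog G₁))))‖ := by
      rw [hid]
      have := norm_sub_le ((((exp (mlog G₄) - 1 - (mlog G₄))) - ((exp (mlog G₃) - 1 - (mlog G₃))) - ((exp (mlog G₂) - 1 - (mlog G₂))) + ((exp (mlog G₁) - 1 - (mlog G₁)))) + P)
        ((((exp (mlog G₄) - 1 - (mlog G₄))) - ((exp (mlog G₃) - 1 - (mlog G₃))) - ((exp (mlog G₂) - 1 - (mlog G₂))) + ((exp (mlog G₁) - 1 - (mlog G₁)))))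
      simpa using this
    linarith
  have h2 : (Real.exp (2 * ρ) - 1) * ‖P‖ ≤ 2 / 3 * ‖P‖ := mul_le_mul_of_nonneg_right (by linarith) (norm_nonneg _)
  have h3 : Real.exp (2 * ρ) * (4 / 3 * l * (4 / 3 * m)) ≤ 5 / 3 * (4 / 3 * l * (4 / 3 * m)) :=
    mul_le_mul_of_nonneg_right he (by positivity)
  linarith

/-- **Remainder form**: `‖pg (log G) − pg G‖ ≤ 12ρ·δ + 12·l·m` on `‖Gᵢ − 1‖ ≤ ρ ≤ 1∕4` — the second differences of the
map `G ↦ log G − (G − 1)` are `O(ρ)`-small relative to those of `G`, up to the quadratic `l·m`. [folklore] -/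
theorem norm_pg_mlog_sub_pg_le {G₁ G₂ G₃ G₄ : 𝔸} {ρ l m δ : ℝ} (hρ : ρ ≤ 1 / 4)
    (h₁ : ‖G₁ - 1‖ ≤ ρ) (h₂ : ‖G₂ - 1‖ ≤ ρ) (h₃ : ‖G₃ - 1‖ ≤ ρ) (h₄ : ‖G₄ - 1‖ ≤ ρ)
    (h12 : ‖G₂ - G₁‖ ≤ l) (h34 : ‖G₄ - G₃‖ ≤ l) (h13 : ‖G₃ - G₁‖ ≤ m) (h24 : ‖G₄ - G₂‖ ≤ m)
    (hδ : ‖(G₄ - G₃ - G₂ + G₁)‖ ≤ δ) :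
    ‖((mlog G₄) - (mlog G₃) - (mlog G₂) + (mlog G₁)) - (G₄ - G₃ - G₂ + G₁)‖ ≤ 12 * ρ * δ + 12 * (l * m) := by
  have hρ0 : 0 ≤ ρ := (norm_nonneg _).trans h₁
  have hl0 : 0 ≤ l := (norm_nonneg _).trans h12
  have hm0 : 0 ≤ m := (norm_nonneg _).trans h13
  have hδ0 : 0 ≤ δ := (norm_nonneg _).trans hδ
  have hlt : ∀ {G : 𝔸}, ‖G - 1‖ ≤ ρ → ‖G - 1‖ < 1 := fun h => h.trans_lt (hρ.trans_lt (by norm_num))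
  have hX : ∀ {G : 𝔸}, ‖G - 1‖ ≤ ρ → ‖mlog G‖ ≤ 2 * ρ := fun h => norm_mlog_le_of_le h hρ
  have hL : ∀ {A B : 𝔸} {t : ℝ}, ‖A - 1‖ ≤ ρ → ‖B - 1‖ ≤ ρ → ‖A - B‖ ≤ t → ‖mlog A - mlog B‖ ≤ 4 / 3 * t :=
    fun hA hB ht => (norm_mlog_sub_mlog_le_four_thirds hρ hA hB).trans (by gcongr)
  have hGX : ∀ {G : 𝔸}, ‖G - 1‖ ≤ ρ → G = (exp (mlog G) - 1 - (mlog G)) + mlog G + 1 := fun h => by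
    rw [exp_mlog (hlt h)]; abel
  have hP := norm_pg_mlog_le hρ h₁ h₂ h₃ h₄ h12 h34 h13 h24 hδ
  have hid1 : (G₄ - G₃ - G₂ + G₁) = (((exp (mlog G₄) - 1 - (mlog G₄))) - ((exp (mlog G₃) - 1 - (mlog G₃))) - ((exp (mlog G₂) - 1 - (mlog G₂))) + ((exp (mlog G₁) - 1 - (mlog G₁))))
      + ((mlog G₄) - (mlog G₃) - (mlog G₂) + (mlog G₁)) := by
    conv_lhs => rw [hGX h₁, hGX h₂, hGX h₃, hGX h₄]
    abel
  have hid : ((mlog G₄) - (mlog G₃) - (mlog G₂) + (mlog G₁)) - (G₄ - G₃ - G₂ + G₁)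
      = -(((exp (mlog G₄) - 1 - (mlog G₄))) - ((exp (mlog G₃) - 1 - (mlog G₃))) - ((exp (mlog G₂) - 1 - (mlog G₂))) + ((exp (mlog G₁) - 1 - (mlog G₁)))) := by
    rw [hid1]; abel
  rw [hid, norm_neg]
  have hT := norm_pg_expTail_le (hX h₁) (hX h₂) (hX h₃) (hX h₄) (hL h₂ h₁ h12) (hL h₄ h₃ h34) (hL h₃ h₁ h13)
    (hL h₄ h₂ h24) hP
  -- numerics: `e^{2ρ} − 1 ≤ 4ρ`, `e^{2ρ} ≤ 5/3`
  have he1 : Real.exp (2 * ρ) - 1 ≤ 2 * (2 * ρ) := real_exp_sub_one_le_two_mul (by linarith) (by linarith)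
  have he : Real.exp (2 * ρ) ≤ 5 / 3 := real_exp_two_mul_le hρ
  have hlm : 0 ≤ l * m := mul_nonneg hl0 hm0
  have hP0 : 0 ≤ 3 * δ + 9 * (l * m) := by positivity
  calc ‖(((exp (mlog G₄) - 1 - (mlog G₄))) - ((exp (mlog G₃) - 1 - (mlog G₃))) - ((exp (mlog G₂) - 1 - (mlog G₂))) + ((exp (mlog G₁) - 1 - (mlog G₁))))‖
      ≤ (Real.exp (2 * ρ) - 1) * (3 * δ + 9 * (l * m)) + Real.exp (2 * ρ) * (4 / 3 * l * (4 / 3 * m)) := hT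
    _ ≤ 2 * (2 * ρ) * (3 * δ + 9 * (l * m)) + 5 / 3 * (4 / 3 * l * (4 / 3 * m)) :=
        add_le_add (mul_le_mul_of_nonneg_right he1 hP0) (mul_le_mul_of_nonneg_right he (by positivity))
    _ = 12 * ρ * δ + (36 * ρ + 80 / 27) * (l * m) := by ring
    _ ≤ 12 * ρ * δ + 12 * (l * m) := by nlinarith

end

end Summit.QuantumFields.BalabanUV.T4Continuum.NE7ExpLogSecondOrder
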